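import Literature.NumberTheory.Automorphic.ArchCellStabilizerField
import Literature.NumberTheory.Automorphic.ArchDistributionLeftTranslate
import HarnessLib

/-!
# The stabilizer field in the basis of root fields: coordinates, supports, eigenvalue data

[cite: Shalika1974, §2, Thm. 2.1]; [cite: HormanderALPDO1, Thm. 2.3.5].

Continuation of `ArchCellStabilizerField` (Shalika's small-cell analysis for `GL_n(K_∞)`, first-order
step, cf. J. A. Shalika, *The multiplicity one theorem for `GL_n`*, Ann. of Math. 100 (1974), §2).  To feed the
abstract first-order descent (`Literature.Analysis.Distribution.vanish_near_of_firstOrder`) the stabilizer datum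
`stabT = -stabY·Ψ + Ψ·stabX` has to be expanded in the *constant* root fields `L_{E_{kl} ε}`, `R_{E_{kl} ε}` of the
chart `ẇΨ`, with smooth real coefficient functions.  This file provides the finite-dimensional algebra for it:

* §1 real coordinates on `K_∞` at a place index `v`: the units `placeUnit v 0 = 1_v`, `placeUnit v 1 = i_v`
  (`placeIdemI`, zero at a real place) and the coordinates `placeCoord v s` (real and imaginary part of the
  `v`-component), with the reconstruction `x = Σ_s placeCoord v s x • placeUnit v s` for `x = 1_v x`
  (`sum_placeCoord_smul_placeUnit`), and `placeCoordCLM`;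
* §2 `Ad(ẇ)` on a root vector concentrated at `v`: `ẇ (x E_{kl}) ẇ⁻¹ = x E_{τ_v⁻¹ k, τ_v⁻¹ l}`
  (`adConjGL_multiPermGL_single`);
* §3 supports: with `f = σ⁻¹ ∘ rev` (so that `f = τ_v⁻¹` when `τ_v = rev ∘ σ`), the matrix `stabY e` is
  concentrated at `v` and supported on the pattern `{(k, l) : f k < f l}` (`leftPat`) — at the place `v` it is
  `U Y₀ U⁻¹` with `U = 1 + (π'X₁)_v` block-triangular for `f` and `Y₀ = θ E_{j₀ i₀}` strictly so
  (`stabY_apply_eq_zero`, `placeIdem_mul_stabY`); `stabX e` is concentrated at `v` and strictly upper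
  (`stabX_mem_strictUpper`, `placeIdem_mul_stabX`); whence the reconstruction identities
  `stabY e = Σ_{f k < f l} Σ_s placeCoord v s (stabY e k l) • E_{kl}(placeUnit v s)` (`stabY_eq_sum`) and the
  analogue for `stabX` (`stabX_eq_sum`);
* §4 the values at a point `e₀ = (0, a, 0)` of the cell: `stabY e₀ = Y₀`, `stabX e₀ = (a_{rev j₀}⁻¹ θ a_{rev i₀})
  E_{rev j₀, rev i₀}` (`stabY_of_fst_eq_zero`, `stabX_of_zero`).

Everything is proved; no new facts.
-/

noncomputable section

open NumberField NumberField.InfinitePlace NumberField.mixedEmbedding Set Filter Matrix Complex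
open Literature.Analysis.Distribution
open scoped MatrixGroups Topology Classical ContDiff Matrix.Norms.Operator ComplexConjugate

namespace Literature.NumberTheory.Automorphic

set_option backward.isDefEq.respectTransparency false

variable {n : ℕ} {K : Type} [Field K] [NumberField K]

local notation "R∞" => mixedSpace K
local notation "Mat" => Matrix (Fin n) (Fin n) (mixedSpace K)
local notation "G∞" => GL (Fin n) (mixedSpace K)
local notation "E∞" => CellParam n (mixedSpace K)
local notation "w₀" => ((weylLong n (mixedSpace K) : GL (Fin n) (mixedSpace K)) : Matrix (Fin n) (Fin n) (mixedSpace K))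

/-- `M_n(K_∞)` is finite-dimensional over `ℝ` (local instance, as in `ArchBigCellDerivatives`). [folklore] -/
private theorem finiteDimensional_matrix_mixedSpace_se : FiniteDimensional ℝ (Matrix (Fin n) (Fin n) (mixedSpace K)) :=
  Module.Finite.matrix

attribute [local instance] finiteDimensional_matrix_mixedSpace_se

/-! ### 1. Real coordinates on `K_∞` at a place -/

section Coord

omit [NumberField K] in
/-- **`i_v`**: the element `(0, i·δ_w)` at a complex place index `v = inr w`, and `0` at a real one. [folklore] -/
def placeIdemI : PlaceIdx K → R∞
  | Sum.inl _ => 0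
  | Sum.inr w => (0, Pi.single w I)

omit [NumberField K] in
/-- Components of `i_v`. [folklore] -/
theorem placeEmbC_placeIdemI (v v' : PlaceIdx K) :
    placeEmbC v' (placeIdemI v : R∞) = if v = v' then (match v with | Sum.inl _ => 0 | Sum.inr _ => I) else 0 := by
  rcases v with w | w <;> rcases v' with w' | w'
  · simp [placeIdemI]
  · simp [placeIdemI]
  · simp [placeIdemI]
  · simp only [placeIdemI, placeEmbC_inr, Sum.inr.injEq]
    by_cases h : w = w'
    · subst h; simp
    · rw [if_neg h]; simp [Ne.symm h]

omit [NumberField K] in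
/-- `i_v` is concentrated at `v`. [folklore] -/
theorem placeIdem_mul_placeIdemI (v : PlaceIdx K) : (placeIdem v : R∞) * placeIdemI v = placeIdemI v :=
  ext_placeEmbC fun v' => by
    rw [placeEmbC_placeIdem_mul, placeEmbC_placeIdemI]
    by_cases h : v' = v
    · subst h; simp
    · rw [if_neg h, if_neg (Ne.symm h)]

omit [NumberField K] in
/-- **The real basis of the `v`-component**: `placeUnit v 0 = 1_v`, `placeUnit v 1 = i_v`. [folklore] -/
def placeUnit (v : PlaceIdx K) (s : Fin 2) : R∞ := if s = 0 then placeIdem v else placeIdemI v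

omit [NumberField K] in
/-- **The real coordinates of the `v`-component**: real and imaginary part. [folklore] -/
def placeCoord (v : PlaceIdx K) (s : Fin 2) (x : R∞) : ℝ := if s = 0 then (placeEmbC v x).re else (placeEmbC v x).im

omit [NumberField K] in
/-- `placeUnit v s` is concentrated at `v`. [folklore] -/
theorem placeIdem_mul_placeUnit (v : PlaceIdx K) (s : Fin 2) : (placeIdem v : R∞) * placeUnit v s = placeUnit v s := by
  unfold placeUnit; split_ifs
  · exact placeIdem_mul_self v
  · exact placeIdem_mul_placeIdemI v

omit [NumberField K] in
/-- `placeCoord v s` is additive. [folklore] -/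
theorem placeCoord_add (v : PlaceIdx K) (s : Fin 2) (x y : R∞) : placeCoord v s (x + y) = placeCoord v s x + placeCoord v s y := by
  unfold placeCoord; split_ifs <;> simp [map_add]

omit [NumberField K] in
/-- `placeCoord v s` is `ℝ`-homogeneous. [folklore] -/
theorem placeCoord_smul (v : PlaceIdx K) (s : Fin 2) (c : ℝ) (x : R∞) : placeCoord v s (c • x) = c * placeCoord v s x := by
  unfold placeCoord; split_ifs <;> simp [placeEmbC_smul]

omit [NumberField K] in
/-- `placeCoord v s 0 = 0`. [folklore] -/
@[simp] theorem placeCoord_zero (v : PlaceIdx K) (s : Fin 2) : placeCoord v s (0 : R∞) = 0 := by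
  unfold placeCoord; split_ifs <;> simp

omit [NumberField K] in
/-- `placeCoord v s` only sees the `v`-component. [folklore] -/
theorem placeCoord_placeIdem_mul (v : PlaceIdx K) (s : Fin 2) (x : R∞) : placeCoord v s (placeIdem v * x) = placeCoord v s x := by
  unfold placeCoord; rw [placeEmbC_placeIdem_mul, if_pos rfl]

/-- `placeCoord v s` as a continuous linear form. [folklore] -/
def placeCoordCLM (v : PlaceIdx K) (s : Fin 2) : R∞ →L[ℝ] ℝ :=
  LinearMap.toContinuousLinearMap
    { toFun := placeCoord v s, map_add' := placeCoord_add v s, map_smul' := placeCoord_smul v s }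

/-- Unfolding `placeCoordCLM`. [folklore] -/
@[simp] theorem placeCoordCLM_apply (v : PlaceIdx K) (s : Fin 2) (x : R∞) : placeCoordCLM v s x = placeCoord v s x := rfl

/-- `placeCoord v s` is smooth. [folklore] -/
theorem contDiff_placeCoord (v : PlaceIdx K) (s : Fin 2) : ContDiff ℝ ∞ (placeCoord v s : R∞ → ℝ) :=
  (placeCoordCLM v s).contDiff

omit [NumberField K] in
/-- **Reconstruction of the `v`-component**: `x = Re(x_v) 1_v + Im(x_v) i_v` for `x = 1_v x`. [folklore] -/
theorem sum_placeCoord_smul_placeUnit (v : PlaceIdx K) {x : R∞} (hx : (placeIdem v : R∞) * x = x) :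
    ∑ s : Fin 2, placeCoord v s x • placeUnit v s = x := by
  refine ext_placeEmbC fun v' => ?_
  rw [Fin.sum_univ_two, map_add, placeEmbC_smul, placeEmbC_smul]
  simp only [placeUnit, placeCoord, Fin.isValue, if_true, one_ne_zero, if_false, placeEmbC_placeIdem, placeEmbC_placeIdemI]
  by_cases h : v = v'
  · subst h
    simp only [if_true, mul_one]
    rcases v with w | w
    · -- real place: the component is real
      have hre : placeEmbC (Sum.inl w) x = ((x.1 w : ℝ) : ℂ) := placeEmbC_inl w x
      rw [hre]; simp
    · simp only [placeEmbC_inr]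
      exact Complex.re_add_im (x.2 w)
  · have h1 : ¬v' = v := Ne.symm h
    simp only [h, h1, if_false, mul_zero, add_zero]
    rw [← hx, placeEmbC_placeIdem_mul, if_neg h1]

omit [NumberField K] in
/-- Reconstruction of a scalar multiple of a matrix unit: `Σ_s placeCoord v s x • E_{kl}(placeUnit v s) = E_{kl} x`
for `x = 1_v x`. [folklore] -/
theorem sum_placeCoord_smul_single (v : PlaceIdx K) (k l : Fin n) {x : R∞} (hx : (placeIdem v : R∞) * x = x) :
    ∑ s : Fin 2, placeCoord v s x • (Matrix.single k l (placeUnit v s) : Mat) = Matrix.single k l x := by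
  conv_rhs => rw [← sum_placeCoord_smul_placeUnit v hx]
  rw [Fin.sum_univ_two, Fin.sum_univ_two, Matrix.smul_single, Matrix.smul_single, ← Matrix.single_add]

end Coord

/-! ### 2. `Ad(ẇ)` on root vectors concentrated at a place -/

section AdPerm

/-- Conjugating a matrix unit by a permutation matrix (over a field): `P_ρ (c E_{kl}) P_ρ⁻¹ = c E_{ρ⁻¹k, ρ⁻¹l}`.
[folklore] -/
theorem permGL_conj_single {F : Type*} [Field F] (ρ : Equiv.Perm (Fin n)) (k l : Fin n) (c : F) :
    ((permGL ρ : GL (Fin n) F) : Matrix (Fin n) (Fin n) F) * Matrix.single k l c * (((permGL ρ)⁻¹ : GL (Fin n) F) : Matrix (Fin n) (Fin n) F) =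
      Matrix.single (ρ.symm k) (ρ.symm l) c := by
  ext i j
  rw [mul_permGL_inv_apply, permGL_mul_apply, Matrix.single_apply, Matrix.single_apply]
  have h1 : (k = ρ i ∧ l = ρ j) ↔ (ρ.symm k = i ∧ ρ.symm l = j) := by
    rw [Equiv.symm_apply_eq, Equiv.symm_apply_eq]
  rw [if_congr h1 rfl rfl]

omit [NumberField K] in
/-- The image of a matrix unit under a place embedding. [folklore] -/
theorem single_map_placeEmbC (v : PlaceIdx K) (k l : Fin n) (x : R∞) :
    (Matrix.single k l x : Mat).map (placeEmbC v) = Matrix.single k l (placeEmbC v x) := by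
  ext i j
  simp only [Matrix.map_apply, Matrix.single_apply]
  split_ifs <;> simp

omit [NumberField K] in
/-- The image of `adConjGL g X` under a place embedding. [folklore] -/
theorem adConjGL_map_placeEmbC (v : PlaceIdx K) (g : G∞) (X : Mat) :
    (adConjGL g X).map (placeEmbC v) =
      ((placeGL v g : GL (Fin n) ℂ) : Matrix (Fin n) (Fin n) ℂ) * X.map (placeEmbC v) * (((placeGL v g)⁻¹ : GL (Fin n) ℂ) : Matrix (Fin n) (Fin n) ℂ) := by
  rw [adConjGL, Matrix.map_mul, Matrix.map_mul, ← coe_placeGL, ← coe_placeGL, map_inv]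

/-- **`Ad(ẇ)` on a root vector concentrated at `v`**: `ẇ (x E_{kl}) ẇ⁻¹ = x E_{τ_v⁻¹ k, τ_v⁻¹ l}` for `x = 1_v x`.
[folklore] -/
theorem adConjGL_multiPermGL_single (τ : PlaceIdx K → Equiv.Perm (Fin n)) (v : PlaceIdx K) (k l : Fin n) {x : R∞}
    (hx : (placeIdem v : R∞) * x = x) :
    adConjGL (multiPermGL τ) (Matrix.single k l x) = Matrix.single ((τ v).symm k) ((τ v).symm l) x := by
  refine matrix_ext_placeEmbC fun v' => ?_
  rw [adConjGL_map_placeEmbC, placeGL_multiPermGL, single_map_placeEmbC, single_map_placeEmbC, permGL_conj_single]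
  by_cases h : v' = v
  · subst h; rfl
  · have hx0 : placeEmbC v' x = 0 := by rw [← hx, placeEmbC_placeIdem_mul, if_neg h]
    rw [hx0, Matrix.single_zero, Matrix.single_zero]

end AdPerm

/-! ### 3. Supports of `stabY`, `stabX` and the reconstruction identities -/

section Support

variable (v : PlaceIdx K) (σ : Equiv.Perm (Fin n)) (i₀ j₀ : Fin n) (θ : mixedSpace K)

omit [NumberField K] in
/-- **The pattern function `f = σ⁻¹ ∘ rev`** (`f = τ_v⁻¹` when `τ_v = rev ∘ σ`): `Ad(ẇ⁻¹)𝔫` at the place `v`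
consists of the matrices supported on `{(k, l) : f k < f l}`. [folklore] -/
def patFn (σ : Equiv.Perm (Fin n)) (k : Fin n) : Fin n := σ.symm k.rev

omit [NumberField K] in
/-- `badPair σ k l ↔ k < l ∧ f l < f k`. [folklore] -/
theorem badPair_iff (k l : Fin n) : badPair σ k l ↔ k < l ∧ patFn σ l < patFn σ k := Iff.rfl

omit [NumberField K] in
/-- With `τ_v = rev ∘ σ`, `τ_v⁻¹ = f`. [folklore] -/
theorem perm_symm_eq_patFn {τv : Equiv.Perm (Fin n)} (hτ : τv = Fin.revPerm * σ) (k : Fin n) : τv.symm k = patFn σ k := by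
  subst hτ; rfl

/-- **Entries of `A S B` vanish below the pattern** when `A`, `B` are block-triangular for `b` and `S` is
strictly so. [folklore] -/
theorem conj_apply_eq_zero_of_blockTriangular_strict {R : Type*} [CommRing R] {α : Type*} [LinearOrder α] {b : Fin n → α}
    {A S B : Matrix (Fin n) (Fin n) R} (hA : A.BlockTriangular b) (hB : B.BlockTriangular b)
    (hS : ∀ p q, b q ≤ b p → S p q = 0) (p q : Fin n) (hpq : b q ≤ b p) : (A * S * B) p q = 0 := by
  rw [Matrix.mul_apply]
  refine Finset.sum_eq_zero fun m _ => ?_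
  by_cases hm : b q < b m
  · rw [hB hm, mul_zero]
  · rw [Matrix.mul_apply, Finset.sum_eq_zero, zero_mul]
    intro a _
    by_cases ha : b a < b p
    · rw [hA ha, zero_mul]
    · rw [hS a m ((le_of_not_gt hm).trans (hpq.trans (le_of_not_gt ha))), mul_zero]

omit [NumberField K] in
/-- `1_v • (A S B) = A (1_v • S) B`. [folklore] -/
theorem placeIdem_smul_conj (A S B : Mat) : (placeIdem v : R∞) • (A * S * B) = A * ((placeIdem v : R∞) • S) * B := by
  rw [Matrix.mul_smul, Matrix.smul_mul]

omit [NumberField K] in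
/-- `Y₀ = θ E_{j₀ i₀}` is concentrated at `v` when `θ` is. [folklore] -/
theorem placeIdem_smul_rootLow (hθ : (placeIdem v : R∞) * θ = θ) : (placeIdem v : R∞) • rootLow i₀ j₀ θ = rootLow i₀ j₀ θ := by
  rw [rootLow, Matrix.smul_single, smul_eq_mul, hθ]

/-- **`stabY e` is concentrated at `v`.** [folklore] -/
theorem placeIdem_smul_stabY (hθ : (placeIdem v : R∞) * θ = θ) (e : E∞) :
    (placeIdem v : R∞) • stabY v σ i₀ j₀ θ e = stabY v σ i₀ j₀ θ e := by
  rw [stabY, placeIdem_smul_conj, placeIdem_smul_rootLow v i₀ j₀ θ hθ]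

/-- **`stabX e` is concentrated at `v`.** [folklore] -/
theorem placeIdem_smul_stabX (hθ : (placeIdem v : R∞) * θ = θ) (e : E∞) :
    (placeIdem v : R∞) • stabX i₀ j₀ θ e = stabX i₀ j₀ θ e := by
  rw [stabX, placeIdem_smul_conj, placeIdem_smul_conj, placeIdem_smul_rootLow v i₀ j₀ θ hθ]

omit [NumberField K] in
/-- `w⁰ (θ E_{j₀ i₀}) w⁰ = θ E_{rev j₀, rev i₀}`. [folklore] -/
theorem weylLong_rootLow_weylLong : w₀ * rootLow i₀ j₀ θ * w₀ = Matrix.single j₀.rev i₀.rev θ := by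
  funext p q
  rw [weylLong_conj_apply, rootLow, Matrix.single_apply, Matrix.single_apply]
  by_cases h : j₀.rev = p ∧ i₀.rev = q
  · rw [if_pos h, if_pos]; exact ⟨by rw [← h.1, Fin.rev_rev], by rw [← h.2, Fin.rev_rev]⟩
  · rw [if_neg h, if_neg]; rintro ⟨h1, h2⟩; exact h ⟨by rw [h1, Fin.rev_rev], by rw [h2, Fin.rev_rev]⟩

/-- The torus–unipotent factor as a unit. [folklore] -/
theorem torusUnip_eq_coe {e : E∞} (he : e ∈ cellSource n R∞) :
    torusUnip e = ((diagUnitsGL e.2.1 he * unitri (e.2.2 : Mat) e.2.2.2 : G∞) : Mat) := by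
  rw [Units.val_mul, coe_diagUnitsGL, coe_unitri]; rfl

/-- The torus–unipotent factor is upper triangular. [folklore] -/
theorem blockTriangular_torusUnip (e : E∞) : (torusUnip e).BlockTriangular id :=
  (Matrix.blockTriangular_diagonal _).mul fun i j hij => by
    have hij' : j < i := hij
    rw [Matrix.add_apply, Matrix.one_apply, if_neg (ne_of_gt hij'), e.2.2.2 i j hij'.le, add_zero]

/-- Its inverse is upper triangular. [folklore] -/
theorem blockTriangular_inverse_torusUnip {e : E∞} (he : e ∈ cellSource n R∞) : (Ring.inverse (torusUnip e)).BlockTriangular id := by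
  rw [torusUnip_eq_coe he, Ring.inverse_unit, Matrix.coe_units_inv]
  haveI : Invertible ((diagUnitsGL e.2.1 he * unitri (e.2.2 : Mat) e.2.2.2 : G∞) : Mat) := Units.invertible _
  exact Matrix.blockTriangular_inv_of_blockTriangular (by rw [← torusUnip_eq_coe he]; exact blockTriangular_torusUnip e)

/-- **`stabX e` is strictly upper** (`e ∈ cellSource`, `i₀ < j₀`). [folklore] -/
theorem stabX_mem_strictUpper (hij : i₀ < j₀) {e : E∞} (he : e ∈ cellSource n R∞) : stabX i₀ j₀ θ e ∈ strictUpper n R∞ := by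
  intro p q hpq
  rw [stabX, weylLong_rootLow_weylLong]
  refine conj_apply_eq_zero_of_blockTriangular_strict (b := id) (blockTriangular_inverse_torusUnip he) (blockTriangular_torusUnip e)
    (fun p' q' h => ?_) p q hpq
  rw [Matrix.single_apply, if_neg]
  rintro ⟨rfl, rfl⟩
  exact absurd (Fin.rev_lt_rev.2 hij) (not_lt.2 h)

/-- The image of `1 + π'X₁` at the place `v` is block-triangular for `f`. [folklore] -/
theorem blockTriangular_unipGood_map (e : E∞) : ((unipGood v σ e).map (placeEmbC v)).BlockTriangular (patFn σ) := by
  intro i j hij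
  rw [Matrix.map_apply, unipGood, Matrix.add_apply, Matrix.one_apply, piGood, Matrix.sub_apply, piBad_apply]
  have hne : i ≠ j := fun h => by subst h; exact lt_irrefl _ hij
  rw [if_neg hne, zero_add]
  by_cases hlt : i < j
  · rw [if_pos (show badPair σ i j from ⟨hlt, hij⟩), map_sub, placeEmbC_placeIdem_mul, if_pos rfl, sub_self]
  · rw [if_neg (fun h : badPair σ i j => hlt h.1), sub_zero, e.1.2 i j (not_lt.1 hlt), map_zero]

/-- The image of `stabY e` at the place `v` as a conjugate in `GL_n(ℂ)`. [folklore] -/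
theorem stabY_map_placeEmbC (e : E∞) :
    (stabY v σ i₀ j₀ θ e).map (placeEmbC v) =
      (unipGood v σ e).map (placeEmbC v) * Matrix.single j₀ i₀ (placeEmbC v θ) * ((unipGood v σ e).map (placeEmbC v))⁻¹ := by
  obtain ⟨u, hu⟩ := isUnit_unipGood v σ e
  rw [stabY, Matrix.map_mul, Matrix.map_mul, rootLow, single_map_placeEmbC, ← hu, Ring.inverse_unit, ← coe_placeGL, ← coe_placeGL,
    map_inv, Matrix.coe_units_inv]

/-- At another place the image of `stabY e` vanishes. [folklore] -/
theorem stabY_map_placeEmbC_of_ne (hθ : (placeIdem v : R∞) * θ = θ) {v' : PlaceIdx K} (hv' : v' ≠ v) (e : E∞) :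
    (stabY v σ i₀ j₀ θ e).map (placeEmbC v') = 0 := by
  have h0 : placeEmbC v' θ = 0 := by rw [← hθ, placeEmbC_placeIdem_mul, if_neg hv']
  rw [stabY, Matrix.map_mul, Matrix.map_mul, rootLow, single_map_placeEmbC, h0, Matrix.single_zero, Matrix.mul_zero, Matrix.zero_mul]

/-- **`stabY e` is supported on the pattern `{f k < f l}`** (bad pair `(i₀, j₀)`, `θ = 1_v θ`). [folklore] -/
theorem stabY_apply_eq_zero (hbad : badPair σ i₀ j₀) (hθ : (placeIdem v : R∞) * θ = θ) (e : E∞) {p q : Fin n}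
    (hpq : patFn σ q ≤ patFn σ p) : stabY v σ i₀ j₀ θ e p q = 0 := by
  refine eq_zero_iff_placeEmbC.2 fun v' => ?_
  by_cases hv' : v' = v
  · subst hv'
    rw [← Matrix.map_apply (f := placeEmbC v') (M := stabY v' σ i₀ j₀ θ e), stabY_map_placeEmbC]
    haveI : Invertible ((unipGood v' σ e).map (placeEmbC v')) :=
      ((isUnit_unipGood v' σ e).map (placeEmbC v').mapMatrix).invertible
    refine conj_apply_eq_zero_of_blockTriangular_strict (blockTriangular_unipGood_map v' σ e)
      (Matrix.blockTriangular_inv_of_blockTriangular (blockTriangular_unipGood_map v' σ e)) (fun p' q' h => ?_) p q hpq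
    rw [Matrix.single_apply, if_neg]
    rintro ⟨rfl, rfl⟩
    exact absurd hbad.2 (not_lt.2 h)
  · rw [← Matrix.map_apply (f := placeEmbC v') (M := stabY v σ i₀ j₀ θ e), stabY_map_placeEmbC_of_ne v σ i₀ j₀ θ hθ hv', Matrix.zero_apply]

omit [NumberField K] in
/-- **Reconstruction of a matrix concentrated at `v` and supported on a pattern `P`** from its entries on `P`
in the real basis `E_{kl}(placeUnit v s)`. [folklore] -/
theorem eq_sum_subtype_single {P : Fin n × Fin n → Prop} [DecidablePred P] (M : Mat) (hM : ∀ k l, ¬P (k, l) → M k l = 0)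
    (hv : (placeIdem v : R∞) • M = M) :
    M = ∑ kl : {kl : Fin n × Fin n // P kl}, ∑ s : Fin 2, placeCoord v s (M kl.1.1 kl.1.2) • Matrix.single kl.1.1 kl.1.2 (placeUnit v s) := by
  have hv' : ∀ k l, (placeIdem v : R∞) * M k l = M k l := fun k l => by
    conv_rhs => rw [← hv]
    rfl
  have h1 : ∀ kl : {kl : Fin n × Fin n // P kl},
      ∑ s : Fin 2, placeCoord v s (M kl.1.1 kl.1.2) • Matrix.single kl.1.1 kl.1.2 (placeUnit v s) = Matrix.single kl.1.1 kl.1.2 (M kl.1.1 kl.1.2) :=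
    fun kl => sum_placeCoord_smul_single v _ _ (hv' _ _)
  simp only [h1]
  have h2 : ∑ kl : {kl : Fin n × Fin n // ¬P kl}, Matrix.single kl.1.1 kl.1.2 (M kl.1.1 kl.1.2) = 0 :=
    Finset.sum_eq_zero fun kl _ => by rw [hM _ _ kl.2, Matrix.single_zero]
  rw [← add_zero (∑ kl : {kl : Fin n × Fin n // P kl}, _), ← h2,
    Fintype.sum_subtype_add_sum_subtype P fun kl : Fin n × Fin n => Matrix.single kl.1 kl.2 (M kl.1 kl.2), Fintype.sum_prod_type]
  exact Matrix.matrix_eq_sum_single M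

omit [NumberField K] in
/-- The index set of the left pattern. [folklore] -/
abbrev LeftPatIdx (σ : Equiv.Perm (Fin n)) : Type := {kl : Fin n × Fin n // patFn σ kl.1 < patFn σ kl.2}

omit [NumberField K] in
/-- The index set of the strictly upper positions. [folklore] -/
abbrev UpperIdx (n : ℕ) : Type := {kl : Fin n × Fin n // kl.1 < kl.2}

/-- **Expansion of `stabY e` in the root units of `Ad(ẇ⁻¹)𝔫` at `v`.** [folklore] -/
theorem stabY_eq_sum (hbad : badPair σ i₀ j₀) (hθ : (placeIdem v : R∞) * θ = θ) (e : E∞) :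
    stabY v σ i₀ j₀ θ e = ∑ kl : LeftPatIdx σ, ∑ s : Fin 2,
      placeCoord v s (stabY v σ i₀ j₀ θ e kl.1.1 kl.1.2) • Matrix.single kl.1.1 kl.1.2 (placeUnit v s) :=
  eq_sum_subtype_single v _ (fun _ _ h => stabY_apply_eq_zero v σ i₀ j₀ θ hbad hθ e (not_lt.1 h)) (placeIdem_smul_stabY v σ i₀ j₀ θ hθ e)

/-- **Expansion of `stabX e` in the root units of `𝔫` at `v`.** [folklore] -/
theorem stabX_eq_sum (hij : i₀ < j₀) (hθ : (placeIdem v : R∞) * θ = θ) {e : E∞} (he : e ∈ cellSource n R∞) :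
    stabX i₀ j₀ θ e = ∑ kl : UpperIdx n, ∑ s : Fin 2,
      placeCoord v s (stabX i₀ j₀ θ e kl.1.1 kl.1.2) • Matrix.single kl.1.1 kl.1.2 (placeUnit v s) :=
  eq_sum_subtype_single v _ (fun k l h => stabX_mem_strictUpper i₀ j₀ θ hij he k l (not_lt.1 h)) (placeIdem_smul_stabX v i₀ j₀ θ hθ e)

end Support

/-! ### 4. Values at a point `e₀ = (0, a, 0)` of the cell -/

section Values

variable (v : PlaceIdx K) (σ : Equiv.Perm (Fin n)) (i₀ j₀ : Fin n) (θ : mixedSpace K)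

/-- `1 + π'X₁ = 1` when `X₁ = 0`. [folklore] -/
theorem unipGood_of_fst_eq_zero {e : E∞} (h₁ : e.1 = 0) : unipGood v σ e = 1 := by
  rw [unipGood, h₁, ZeroMemClass.coe_zero, piGood_zero, add_zero]

/-- **`stabY e₀ = Y₀`** when `X₁ = 0`. [folklore] -/
theorem stabY_of_fst_eq_zero {e : E∞} (h₁ : e.1 = 0) : stabY v σ i₀ j₀ θ e = rootLow i₀ j₀ θ := by
  rw [stabY, unipGood_of_fst_eq_zero v σ h₁, Ring.inverse_one, Matrix.one_mul, Matrix.mul_one]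

/-- `diag(a) (1 + X₂) = diag(a)` when `X₂ = 0`. [folklore] -/
theorem torusUnip_of_snd_snd_eq_zero {e : E∞} (h₂ : e.2.2 = 0) : torusUnip e = Matrix.diagonal e.2.1 := by
  rw [torusUnip, h₂, ZeroMemClass.coe_zero, add_zero, Matrix.mul_one]

omit [NumberField K] in
/-- `diag(d) (c E_{pq}) diag(a) = (d_p c a_q) E_{pq}`. [folklore] -/
theorem diagonal_mul_single_mul_diagonal (d a : Fin n → R∞) (p q : Fin n) (c : R∞) :
    Matrix.diagonal d * Matrix.single p q c * Matrix.diagonal a = Matrix.single p q (d p * c * a q) := by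
  funext i j
  rw [Matrix.mul_diagonal, Matrix.diagonal_mul, Matrix.single_apply, Matrix.single_apply]
  split_ifs with h
  · rw [h.1, h.2]
  · rw [mul_zero, zero_mul]

/-- **`stabX e₀ = (a_{rev j₀}⁻¹ θ a_{rev i₀}) E_{rev j₀, rev i₀}`** at `e₀ = (X₁, a, 0) ∈ cellSource`. [folklore] -/
theorem stabX_of_snd_snd_eq_zero {e : E∞} (he : e ∈ cellSource n R∞) (h₂ : e.2.2 = 0) :
    stabX i₀ j₀ θ e = Matrix.single j₀.rev i₀.rev (↑((he j₀.rev).unit⁻¹) * θ * e.2.1 i₀.rev) := by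
  rw [stabX, weylLong_rootLow_weylLong, torusUnip_of_snd_snd_eq_zero h₂, ← coe_diagUnitsGL e.2.1 he, Ring.inverse_unit,
    ← diagInv, diagInv_eq he, coe_diagUnitsGL, diagonal_mul_single_mul_diagonal]

end Values

/-! ### 5. Derivatives of `stabY`, `stabX` along lines, and the field directions at `e₀` -/

section LineDeriv

variable (v : PlaceIdx K) (σ : Equiv.Perm (Fin n)) (i₀ j₀ : Fin n) (θ : mixedSpace K)

/-- **`t ↦ (1 + tN)⁻¹` has derivative `-N` at `0`.** [folklore] -/
theorem hasDerivAt_inverse_one_add_smul (N : Mat) : HasDerivAt (fun t : ℝ => Ring.inverse ((1 : Mat) + t • N)) (-N) 0 := by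
  have h1 : HasDerivAt (fun t : ℝ => (1 : Mat) + t • N) N 0 := by
    simpa using ((hasDerivAt_id (0 : ℝ)).smul_const N).const_add (1 : Mat)
  have h2 := (hasFDerivAt_ringInverse (𝕜 := ℝ) (1 : Matˣ)).comp_hasDerivAt_of_eq (0 : ℝ) h1 (by simp)
  have h3 : (-ContinuousLinearMap.mulLeftRight ℝ Mat (((1 : Matˣ)⁻¹ : Matˣ) : Mat) (((1 : Matˣ)⁻¹ : Matˣ) : Mat)) N = -N := by
    simp
  rw [h3] at h2
  exact h2

/-- Along any line through a point with `X₁ = 0`: `1 + π'X₁ = 1 + t π'δ₁`. [folklore] -/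
theorem unipGood_add_smul {e₀ : E∞} (h₁ : e₀.1 = 0) (δ : E∞) (t : ℝ) : unipGood v σ (e₀ + t • δ) = 1 + t • piGood v σ (δ.1 : Mat) := by
  rw [unipGood]
  have : ((e₀ + t • δ).1 : Mat) = t • (δ.1 : Mat) := by simp [h₁]
  rw [this, piGood_smul]

/-- **The derivative of `stabY` along a line through `e₀` with `X₁ = 0`**: `[π'δ₁, Y₀]`. [folklore] -/
theorem hasDerivAt_stabY_line {e₀ : E∞} (h₁ : e₀.1 = 0) (δ : E∞) :
    HasDerivAt (fun t : ℝ => stabY v σ i₀ j₀ θ (e₀ + t • δ))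
      (piGood v σ (δ.1 : Mat) * rootLow i₀ j₀ θ - rootLow i₀ j₀ θ * piGood v σ (δ.1 : Mat)) 0 := by
  have hfun : (fun t : ℝ => stabY v σ i₀ j₀ θ (e₀ + t • δ)) =
      fun t => ((1 : Mat) + t • piGood v σ (δ.1 : Mat)) * rootLow i₀ j₀ θ * Ring.inverse ((1 : Mat) + t • piGood v σ (δ.1 : Mat)) := by
    funext t; rw [stabY, unipGood_add_smul v σ h₁]
  rw [hfun]
  have hc : HasDerivAt (fun t : ℝ => ((1 : Mat) + t • piGood v σ (δ.1 : Mat)) * rootLow i₀ j₀ θ) (piGood v σ (δ.1 : Mat) * rootLow i₀ j₀ θ) 0 := by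
    have h1 : HasDerivAt (fun t : ℝ => (1 : Mat) + t • piGood v σ (δ.1 : Mat)) (piGood v σ (δ.1 : Mat)) 0 := by
      simpa using ((hasDerivAt_id (0 : ℝ)).smul_const (piGood v σ (δ.1 : Mat))).const_add (1 : Mat)
    exact h1.mul_const (rootLow i₀ j₀ θ)
  have h := hc.mul (hasDerivAt_inverse_one_add_smul (piGood v σ (δ.1 : Mat)))
  simp only [zero_smul, add_zero, Ring.inverse_one, Matrix.mul_one, Matrix.one_mul, mul_neg] at h
  rw [sub_eq_add_neg]
  exact h

omit [NumberField K] in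
/-- The inverse of a product of two units. [folklore] -/
theorem inverse_mul_of_isUnit {a b : Mat} (ha : IsUnit a) (hb : IsUnit b) : Ring.inverse (a * b) = Ring.inverse b * Ring.inverse a := by
  obtain ⟨ua, rfl⟩ := ha
  obtain ⟨ub, rfl⟩ := hb
  rw [← Units.val_mul, Ring.inverse_unit, Ring.inverse_unit, Ring.inverse_unit, _root_.mul_inv_rev, Units.val_mul]

/-- Along a line through `e₀` with `X₂ = 0` in a direction with `δ_a = 0`: `diag(a)(1 + X₂) = diag(a) (1 + t δ₂)`.
[folklore] -/
theorem torusUnip_add_smul {e₀ δ : E∞} (h₂ : e₀.2.2 = 0) (hδ : δ.2.1 = 0) (t : ℝ) :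
    torusUnip (e₀ + t • δ) = Matrix.diagonal e₀.2.1 * (1 + t • (δ.2.2 : Mat)) := by
  rw [torusUnip]
  have ha : (e₀ + t • δ).2.1 = e₀.2.1 := by simp [hδ]
  have hX : ((e₀ + t • δ).2.2 : Mat) = t • (δ.2.2 : Mat) := by simp [h₂]
  rw [ha, hX]

/-- Along such a line, `stabX = (1 + tδ₂)⁻¹ (stabX e₀) (1 + tδ₂)`. [folklore] -/
theorem stabX_add_smul {e₀ δ : E∞} (he₀ : e₀ ∈ cellSource n R∞) (h₂ : e₀.2.2 = 0) (hδ : δ.2.1 = 0) (t : ℝ) :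
    stabX i₀ j₀ θ (e₀ + t • δ) = Ring.inverse ((1 : Mat) + t • (δ.2.2 : Mat)) * stabX i₀ j₀ θ e₀ * (1 + t • (δ.2.2 : Mat)) := by
  have hD : IsUnit (Matrix.diagonal e₀.2.1 : Mat) := ⟨diagUnitsGL e₀.2.1 he₀, rfl⟩
  have hU : IsUnit ((1 : Mat) + t • (δ.2.2 : Mat)) :=
    ⟨unitri (t • (δ.2.2 : Mat)) ((strictUpperReal n R∞).smul_mem t δ.2.2.2), rfl⟩
  rw [stabX, stabX, torusUnip_add_smul h₂ hδ, torusUnip_of_snd_snd_eq_zero h₂, inverse_mul_of_isUnit hD hU]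
  noncomm_ring

/-- **The derivative of `stabX` along such a line**: `[stabX e₀, δ₂]`. [folklore] -/
theorem hasDerivAt_stabX_line {e₀ δ : E∞} (he₀ : e₀ ∈ cellSource n R∞) (h₂ : e₀.2.2 = 0) (hδ : δ.2.1 = 0) :
    HasDerivAt (fun t : ℝ => stabX i₀ j₀ θ (e₀ + t • δ))
      (stabX i₀ j₀ θ e₀ * (δ.2.2 : Mat) - (δ.2.2 : Mat) * stabX i₀ j₀ θ e₀) 0 := by
  have hfun : (fun t : ℝ => stabX i₀ j₀ θ (e₀ + t • δ)) =
      fun t => Ring.inverse ((1 : Mat) + t • (δ.2.2 : Mat)) * stabX i₀ j₀ θ e₀ * (1 + t • (δ.2.2 : Mat)) :=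
    funext fun t => stabX_add_smul i₀ j₀ θ he₀ h₂ hδ t
  rw [hfun]
  have h1 : HasDerivAt (fun t : ℝ => (1 : Mat) + t • (δ.2.2 : Mat)) (δ.2.2 : Mat) 0 := by
    simpa using ((hasDerivAt_id (0 : ℝ)).smul_const (δ.2.2 : Mat)).const_add (1 : Mat)
  have h := ((hasDerivAt_inverse_one_add_smul (δ.2.2 : Mat)).mul_const (stabX i₀ j₀ θ e₀)).mul h1
  simp only [zero_smul, add_zero, Ring.inverse_one, Matrix.mul_one, Matrix.one_mul, neg_mul] at h
  rw [sub_eq_add_neg, add_comm]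
  exact h

/-- **The `X₁`-component of `L_Y` at `e₀ = (0, a, 0)` is `-upPart Y`.** [folklore] -/
theorem cellVecL_fst_apply_of_zero {e₀ : E∞} (he₀ : e₀ ∈ cellSource n R∞) (h₁ : e₀.1 = 0) (h₂ : e₀.2.2 = 0) (Y : Mat)
    (p q : Fin n) : ((cellVecL Y e₀).1 : Mat) p q = if p < q then -Y p q else 0 := by
  rw [cellVecL_eq he₀, cellTangentInv_fst_apply_of_zero he₀ h₁ h₂, cellChart_of_zero h₁ h₂]
  split_ifs with hpq
  · rw [Matrix.neg_apply, ← Matrix.mul_assoc, Matrix.mul_diagonal, mul_weylLong_apply, Fin.rev_rev, neg_mul, mul_assoc,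
      IsUnit.mul_val_inv, mul_one]
  · rfl

/-- **`R_X` at `e₀ = (0, a, 0)` for `X ∈ 𝔫`: the `X₂`-component is `X`…** [folklore] -/
theorem cellVecR_snd_snd_of_zero {e₀ : E∞} (he₀ : e₀ ∈ cellSource n R∞) (h₁ : e₀.1 = 0) (h₂ : e₀.2.2 = 0) {X : Mat}
    (hX : X ∈ strictUpper n R∞) : ((cellVecR X e₀).2.2 : Mat) = X := by
  funext p q
  rw [cellVecR_eq he₀, cellTangentInv_snd_snd_apply_of_zero he₀ h₁ h₂, cellChart_of_zero h₁ h₂]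
  split_ifs with hpq
  · rw [Matrix.mul_assoc, weylLong_mul_apply, Fin.rev_rev, Matrix.diagonal_mul, ← mul_assoc, IsUnit.val_inv_mul, one_mul]
  · exact (hX p q (not_lt.1 hpq)).symm

/-- **… and the `a`-component vanishes.** [folklore] -/
theorem cellVecR_snd_fst_of_zero {e₀ : E∞} (he₀ : e₀ ∈ cellSource n R∞) (h₁ : e₀.1 = 0) (h₂ : e₀.2.2 = 0) {X : Mat}
    (hX : X ∈ strictUpper n R∞) : (cellVecR X e₀).2.1 = 0 := by
  funext i
  rw [cellVecR_eq he₀, cellTangentInv_snd_fst_of_zero he₀ h₁ h₂, cellChart_of_zero h₁ h₂, Matrix.mul_assoc, weylLong_mul_apply,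
    Fin.rev_rev, Matrix.diagonal_mul, hX i i le_rfl, mul_zero]
  rfl

omit [NumberField K] in
/-- The `(k, l)` entry of `[S, Y₀]` vanishes when `S` is supported at `(k, l)` and `i₀ ≠ j₀`. [folklore] -/
theorem comm_rootLow_apply_of_support (hij : i₀ ≠ j₀) {S : Mat} {k l : Fin n} (hS : ∀ p q, S p q ≠ 0 → p = k ∧ q = l) :
    (S * rootLow i₀ j₀ θ - rootLow i₀ j₀ θ * S) k l = 0 := by
  have e1 : (S * Matrix.single j₀ i₀ θ) k l = if l = i₀ then S k j₀ * θ else 0 := by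
    split_ifs with h
    · rw [h]; exact Matrix.mul_single_apply_same θ j₀ i₀ k S
    · exact Matrix.mul_single_apply_of_ne θ j₀ i₀ k l h S
  have e2 : (Matrix.single j₀ i₀ θ * S) k l = if k = j₀ then θ * S i₀ l else 0 := by
    split_ifs with h
    · rw [h]; exact Matrix.single_mul_apply_same θ j₀ i₀ l S
    · exact Matrix.single_mul_apply_of_ne θ j₀ i₀ k l h S
  rw [Matrix.sub_apply, rootLow, e1, e2]
  have h1 : (if l = i₀ then S k j₀ * θ else 0) = 0 := by
    split_ifs with hl
    · by_cases hz : S k j₀ = 0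
      · rw [hz, zero_mul]
      · exact absurd ((hS k j₀ hz).2.trans hl).symm hij
    · rfl
  have h2 : (if k = j₀ then θ * S i₀ l else 0) = 0 := by
    split_ifs with hk
    · by_cases hz : S i₀ l = 0
      · rw [hz, mul_zero]
      · exact absurd ((hS i₀ l hz).1.trans hk) hij
    · rfl
  rw [h1, h2, sub_zero]

omit [NumberField K] in
/-- The `(k, l)` entry of `[X, c E_{kl}]` vanishes for `X` with zero diagonal. [folklore] -/
theorem comm_single_apply_self {X : Mat} (hX : X ∈ strictUpper n R∞) (k l : Fin n) (c : R∞) :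
    (X * Matrix.single k l c - Matrix.single k l c * X) k l = 0 := by
  rw [Matrix.sub_apply, Matrix.mul_single_apply_same c k l k X, Matrix.single_mul_apply_same c k l l X, hX k k le_rfl, hX l l le_rfl,
    zero_mul, mul_zero, sub_zero]

end LineDeriv

/-! ### 6. Linearity of the infinitesimal character -/

section DChar

/-- `dψ_∞` is additive in the root coordinate. [folklore] -/
theorem archWhittakerDChar_add (i j : Fin n) (x y : R∞) :
    archWhittakerDChar K i j (x + y) = archWhittakerDChar K i j x + archWhittakerDChar K i j y := by
  unfold archWhittakerDChar
  split_ifs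
  · rw [map_add]; push_cast; ring
  · rw [add_zero]

/-- `dψ_∞` is `ℝ`-homogeneous in the root coordinate. [folklore] -/
theorem archWhittakerDChar_smul (i j : Fin n) (c : ℝ) (x : R∞) :
    archWhittakerDChar K i j (c • x) = (c : ℂ) * archWhittakerDChar K i j x := by
  unfold archWhittakerDChar
  split_ifs
  · rw [map_smul, smul_eq_mul]; push_cast; ring
  · rw [mul_zero]

/-- `dψ_∞` of a finite sum. [folklore] -/
theorem archWhittakerDChar_sum {ι : Type*} (s : Finset ι) (i j : Fin n) (x : ι → R∞) :
    archWhittakerDChar K i j (∑ a ∈ s, x a) = ∑ a ∈ s, archWhittakerDChar K i j (x a) := by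
  induction s using Finset.cons_induction with
  | empty => simp [archWhittakerDChar]
  | cons a s ha ih => rw [Finset.sum_cons, Finset.sum_cons, archWhittakerDChar_add, ih]

/-- **`dψ_∞` in the real coordinates at `v`**: `Σ_s placeCoord v s x · dψ_∞(E_{ij} placeUnit v s) = dψ_∞(x E_{ij})` for
`x = 1_v x`. [folklore] -/
theorem sum_placeCoord_mul_archWhittakerDChar (v : PlaceIdx K) {x : R∞} (hx : (placeIdem v : R∞) * x = x) (i j : Fin n) :
    ∑ s : Fin 2, (placeCoord v s x : ℂ) * archWhittakerDChar K i j (placeUnit v s) = archWhittakerDChar K i j x := by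
  conv_rhs => rw [← sum_placeCoord_smul_placeUnit v hx, archWhittakerDChar_sum]
  simp only [archWhittakerDChar_smul]

end DChar

end Literature.NumberTheory.Automorphic
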